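import Mathlib.Algebra.Module.CharacterModule
import Mathlib.LinearAlgebra.Quotient.Basic
import Mathlib.LinearAlgebra.Prod
import Summits.BirchSwinnertonDyer.BirchSwinnertonDyer.Theorems.ResidualThetaTransportAtTwoResidualSignedLambdaLowerCMAtTwoFourTermDuality
import HarnessLib

/-!
# The deep half (DH)⊕ of the one-pair road from the RELAXED deep half: Pontryagin annihilators turn `⊓` into `⊔`

Route `ResidualThetaTransportAtTwo` (RTT), crux RSL_g `ResidualSignedLambdaLowerCMAtTwo` (stmt-BirchSwinnertonDyer-22608); seat `prover-bsd-wall-rtt-p2` g16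
(`--supports`, closes nothing). THEOREMS ONLY, pure module algebra (commutative ring `A`, character modules `M⋆ = Hom(M, ℚ/ℤ)`); nothing about
curves, Galois cohomology or `L`-functions is proved here; the arithmetic inputs (DH)_rel and (PERF₂) remain HYPOTHESES. BSD is NOT proved by any of this.

-- adapted from `Cruxes/ResidualThetaCountLowerPureAtTwo/Sketch_sidea_k3_g7.lean` (stub-ideation k3 gen 7, kernel-checked there; STUB-PLAN rev 9 §0 item 4
«k3-g7 G0–G3 land as helpers»): namespace moved under `Theorems.CharIdealLambda`; the sketch's two-line `def toCharProd` is replaced by a local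
term inside the proofs (a Theorems file declares no definitions) — `lift_of_surjective_two` takes the product character `toChar` with its
evaluation formula as a hypothesis instead.

## The cut (matching `CharIdealLambda.le_finrank_baseChange_characterModule_of_duality[_decorated]`, binder `hDH`)
Signed data of the one-pair road: `P = (P₀ ⧸ H¹_+) × P_{S₀}`, `Sel = Sg = {s ∈ SelRel | loc₂ s ∈ E⁺}`, `pair : P → Sg⋆`, `locd : H → P`.
Relaxed data: `P' = P₀ × P_{S₀}`, `SelRel` (NO condition at `2`), the local duality characters `c₂ : P₀ → D₂⋆`, `c_S : P_{S₀} → D_S⋆` and the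
localisations `loc₂, loc_S`; `loc' : H → P'`; `π : P' ↠ P` the coarsening with `locd = π ∘ loc'`, `pair ∘ π = pair'|Sg` and `ker π ⊇ ann(E⁺) × 0`.
* §A  `exists_character_add_of_vanish_inf` — a character of `D` vanishing on `L ⊓ E` is `χ₁ + χ₂` with `χ₁|L = 0`, `χ₂|E = 0`
        (`ℚ/ℤ` injective); `ker_dual_subtype_inf` — `ann(L ⊓ E) = ann L ⊔ ann E`.
* §B  `deepHalf_of_coarsening` (G1) — (DH) descends along any coarsening `π` given (DH)_rel and (SPLIT); `split_of_lift` (G2).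
* §C  `lift_of_surjective_two`, **`deepHalfSigma_of_relaxed`** — (DH)_rel ∧ `Surjective c₂` ⟹ (DH)⊕ VERBATIM in the shape of the binder `hDH`.
* §D  `le_finrank_baseChange_characterModule_of_relaxedDuality_decorated` — `d ≤ λ(Sg⋆)` from (EH_Z), (ORTH), (DH)_rel, (PERF₂) and the three
        λ-inequalities (p664041 `_decorated` re-fed).

References: [MilneADT2006] I Thm. 4.10 (b), I Cor. 2.3; [Rubin2000] App. B §B.3; [Nekovar2006] §0.11, §8.9; [Kobayashi2003] Thm. 7.3
((7.17)–(7.21)); [Greenberg1989] §3; [CoatesGreenberg1996] Prop. 4.3.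
-/

set_option autoImplicit false
set_option linter.dupNamespace false

noncomputable section

open scoped TensorProduct Classical

namespace Summit.BirchSwinnertonDyer.BirchSwinnertonDyer.Theorems.CharIdealLambda


universe u v w

/-! ## §A  Lemma A — Pontryagin annihilators convert `⊓` into `⊔` -/

section LemmaA

variable {D : Type v} [AddCommGroup D]

/-- **Lemma A over `ℤ`.**  If a character `χ : D → ℚ/ℤ` vanishes on `L ⊓ E` then `χ = χ₁ + χ₂` with `χ₁|L = 0` and `χ₂|E = 0`.
Proof: `χ|E` factors through `E ⧸ (E ⊓ L) ↪ D ⧸ L`; extend along this injection (`ℚ/ℤ` is injective) and pull back to `D`. [folklore] -/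
theorem exists_character_add_of_vanish_inf_int (L E : Submodule ℤ D) (χ : CharacterModule D)
    (hχ : ∀ x ∈ L ⊓ E, χ x = 0) :
    ∃ χ₁ χ₂ : CharacterModule D, (∀ x ∈ L, χ₁ x = 0) ∧ (∀ x ∈ E, χ₂ x = 0) ∧ χ = χ₁ + χ₂ := by
  -- `K = E ⊓ L` seen inside `E`, and `f : E → D ⧸ L`
  let K : Submodule ℤ E := L.comap E.subtype
  let f : E →ₗ[ℤ] D ⧸ L := L.mkQ ∘ₗ E.subtype
  have hKf : K ≤ LinearMap.ker f := fun e he ↦ by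
    rw [LinearMap.mem_ker]
    show L.mkQ (e : D) = 0
    rw [Submodule.mkQ_apply, Submodule.Quotient.mk_eq_zero]
    exact he
  have hfK : LinearMap.ker f ≤ K := fun e he ↦ by
    rw [LinearMap.mem_ker] at he
    change L.mkQ (e : D) = 0 at he
    rw [Submodule.mkQ_apply, Submodule.Quotient.mk_eq_zero] at he
    exact he
  -- `j : E ⧸ K ↪ D ⧸ L`
  let j : (E ⧸ K) →ₗ[ℤ] D ⧸ L := K.liftQ f hKf
  have hj : Function.Injective j := by
    rw [← LinearMap.ker_eq_bot]
    exact Submodule.ker_liftQ_eq_bot _ _ _ hfK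
  -- `χ|E` factors through `E ⧸ K`
  let χE : E →ₗ[ℤ] AddCircle (1 : ℚ) := χ.toIntLinearMap ∘ₗ E.subtype
  have hKχ : K ≤ LinearMap.ker χE := fun e he ↦ by
    have h0 : χ (e : D) = 0 := hχ e (Submodule.mem_inf.mpr ⟨he, e.2⟩)
    rw [LinearMap.mem_ker]
    exact h0
  let ψ : CharacterModule (E ⧸ K) := (K.liftQ χE hKχ).toAddMonoidHom
  -- extend `ψ` along the injection `j`, then pull back along `D → D ⧸ L`
  obtain ⟨ψ', hψ'⟩ := CharacterModule.dual_surjective_of_injective j hj ψ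
  refine ⟨CharacterModule.dual L.mkQ ψ', χ - CharacterModule.dual L.mkQ ψ', ?_, ?_, by abel⟩
  · intro x hx
    show ψ' (L.mkQ x) = 0
    rw [Submodule.mkQ_apply, (Submodule.Quotient.mk_eq_zero L).mpr hx, map_zero]
  · intro e he
    have hje : j (K.mkQ ⟨e, he⟩) = L.mkQ e := Submodule.liftQ_apply (h := hKf) K f (⟨e, he⟩ : E)
    have hψe : ψ (K.mkQ ⟨e, he⟩) = χ e := Submodule.liftQ_apply (h := hKχ) K χE (⟨e, he⟩ : E)
    have h1 : CharacterModule.dual L.mkQ ψ' e = χ e := by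
      calc CharacterModule.dual L.mkQ ψ' e = ψ' (L.mkQ e) := rfl
        _ = ψ' (j (K.mkQ ⟨e, he⟩)) := by rw [hje]
        _ = CharacterModule.dual j ψ' (K.mkQ ⟨e, he⟩) := rfl
        _ = χ e := by rw [hψ', hψe]
    show χ e - CharacterModule.dual L.mkQ ψ' e = 0
    rw [h1, sub_self]

/-- **Lemma A** over any ring of scalars (membership only is used). [folklore] -/
theorem exists_character_add_of_vanish_inf {A : Type u} [Ring A] [Module A D] (L E : Submodule A D)
    (χ : CharacterModule D) (hχ : ∀ x ∈ L ⊓ E, χ x = 0) :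
    ∃ χ₁ χ₂ : CharacterModule D, (∀ x ∈ L, χ₁ x = 0) ∧ (∀ x ∈ E, χ₂ x = 0) ∧ χ = χ₁ + χ₂ :=
  exists_character_add_of_vanish_inf_int (L.restrictScalars ℤ) (E.restrictScalars ℤ) χ fun x hx ↦ hχ x ⟨hx.1, hx.2⟩

variable {A : Type u} [CommRing A] [Module A D]

/-- `ann(N) = ker (N ↪ D)⋆` unfolded: `χ ∈ ann(N) ↔ χ|N = 0`. [folklore] -/
theorem mem_ker_dual_subtype_iff (N : Submodule A D) (χ : CharacterModule D) :
    χ ∈ LinearMap.ker (CharacterModule.dual N.subtype) ↔ ∀ x ∈ N, χ x = 0 := by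
  rw [LinearMap.mem_ker]
  refine ⟨fun h x hx ↦ ?_, fun h ↦ ?_⟩
  · exact DFunLike.congr_fun h ⟨x, hx⟩
  · ext x
    exact h x x.2

/-- **Pontryagin annihilators convert `⊓` into `⊔`:** `ann(L ⊓ E) = ann(L) ⊔ ann(E)` in `D⋆` (the inclusion `⊇` is trivial; `⊆` is
Lemma A, i.e. the injectivity of `ℚ/ℤ`).  This is the identity that lets the PLUS local condition leave the Poitou–Tate port. [folklore] -/
theorem ker_dual_subtype_inf (L E : Submodule A D) :
    LinearMap.ker (CharacterModule.dual (L ⊓ E).subtype) =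
      LinearMap.ker (CharacterModule.dual L.subtype) ⊔ LinearMap.ker (CharacterModule.dual E.subtype) := by
  refine le_antisymm (fun χ hχ ↦ ?_) (sup_le (fun χ hχ ↦ ?_) (fun χ hχ ↦ ?_))
  · obtain ⟨χ₁, χ₂, h₁, h₂, rfl⟩ :=
      exists_character_add_of_vanish_inf L E χ ((mem_ker_dual_subtype_iff _ χ).mp hχ)
    exact Submodule.add_mem_sup ((mem_ker_dual_subtype_iff L χ₁).mpr h₁) ((mem_ker_dual_subtype_iff E χ₂).mpr h₂)
  · exact (mem_ker_dual_subtype_iff _ χ).mpr fun x hx ↦ (mem_ker_dual_subtype_iff L χ).mp hχ x hx.1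
  · exact (mem_ker_dual_subtype_iff _ χ).mpr fun x hx ↦ (mem_ker_dual_subtype_iff E χ).mp hχ x hx.2

end LemmaA

/-! ## §B  (DH) descends along a coarsening of the local condition -/

section Coarsening

variable {A : Type u} [CommRing A]
  {P' : Type v} [AddCommGroup P'] [Module A P']
  {P : Type v} [AddCommGroup P] [Module A P]
  {H : Type v} [AddCommGroup H] [Module A H]
  {SelRel : Type v} [AddCommGroup SelRel] [Module A SelRel]

/-- **G1 — (DH) from (DH)_rel and (SPLIT) along any coarsening `π : P' ↠ P`.**  `pair'` = relaxed local pairing with the RELAXED Selmer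
module `SelRel`, `Sg ≤ SelRel` the signed one, `pair ∘ π = pair'|Sg`, `locd = π ∘ loc'`; (DH)_rel: a relaxed local element orthogonal to
ALL of `SelRel` is, up to `A`-torsion, global; (SPLIT): a relaxed element orthogonal to `Sg` is, modulo `ker π`, orthogonal to `SelRel`.
[cite: MilneADT2006, Ch. I, Thm. 4.10 (b)] [cite: Kobayashi2003, Thm. 7.3 ((7.17)–(7.21))] -/
theorem deepHalf_of_coarsening (π : P' →ₗ[A] P) (hπ : Function.Surjective π)
    (pair' : P' →ₗ[A] CharacterModule SelRel) (Sg : Submodule A SelRel)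
    (pair : P →ₗ[A] CharacterModule Sg) (hcompat : ∀ (t : P') (s : Sg), pair (π t) s = pair' t s)
    (loc' : H →ₗ[A] P') (locd : H →ₗ[A] P) (hloc : ∀ x, locd x = π (loc' x))
    (hDHrel : ∀ t : P', pair' t = 0 → ∃ a : A, a ≠ 0 ∧ ∃ x : H, a • t = loc' x)
    (hsplit : ∀ t : P', (∀ s ∈ Sg, pair' t s = 0) → ∃ h : P', π h = 0 ∧ pair' (t - h) = 0) :
    ∀ z : P, pair z = 0 → ∃ a : A, a ≠ 0 ∧ ∃ x : H, a • z = locd x := by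
  intro z hz
  obtain ⟨t, rfl⟩ := hπ z
  have ht : ∀ s ∈ Sg, pair' t s = 0 := fun s hs ↦ by
    have h1 := hcompat t ⟨s, hs⟩
    rw [hz] at h1
    exact h1.symm
  obtain ⟨h, hπh, hth⟩ := hsplit t ht
  obtain ⟨a, ha, x, hx⟩ := hDHrel (t - h) hth
  exact ⟨a, ha, x, by rw [hloc, ← hx, map_smul, map_sub, hπh, sub_zero]⟩

/-- **G2 — (SPLIT) from Lemma A and a lift of `E`-vanishing local characters into `ker π`.**  `toChar : P' → Dloc⋆` the relaxed local
duality character, `locS : SelRel → Dloc` the localisation, `pair' t s = toChar t (locS s)`, `Sg = locS⁻¹(E)`. [folklore] -/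
theorem split_of_lift {Dloc : Type v} [AddCommGroup Dloc] [Module A Dloc]
    (π : P' →ₗ[A] P) (toChar : P' →ₗ[A] CharacterModule Dloc) (locS : SelRel →ₗ[A] Dloc)
    (pair' : P' →ₗ[A] CharacterModule SelRel) (hpair : ∀ (t : P') (s : SelRel), pair' t s = toChar t (locS s))
    (E : Submodule A Dloc) (Sg : Submodule A SelRel) (hSg : ∀ s, s ∈ Sg ↔ locS s ∈ E)
    (hlift : ∀ χ : CharacterModule Dloc, (∀ e ∈ E, χ e = 0) → ∃ h : P', π h = 0 ∧ toChar h = χ) :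
    ∀ t : P', (∀ s ∈ Sg, pair' t s = 0) → ∃ h : P', π h = 0 ∧ pair' (t - h) = 0 := by
  intro t ht
  obtain ⟨χ₁, χ₂, h₁, h₂, hsum⟩ := exists_character_add_of_vanish_inf (LinearMap.range locS) E (toChar t)
    (by
      rintro x ⟨⟨s, rfl⟩, hxE⟩
      rw [← hpair]
      exact ht s ((hSg s).mpr hxE))
  obtain ⟨h, hπh, hh⟩ := hlift χ₂ h₂
  refine ⟨h, hπh, ?_⟩
  have hth : toChar (t - h) = χ₁ := by rw [map_sub, hh, hsum]; abel
  ext s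
  show pair' (t - h) s = 0
  rw [hpair, hth]
  exact h₁ (locS s) ⟨s, rfl⟩

end Coarsening

/-! ## §C  The one-pair road: `P' = P₀ × P_{S₀}`, plus condition at `2` only -/

section OnePair

variable {A : Type u} [CommRing A]
  {P₀ : Type v} [AddCommGroup P₀] [Module A P₀]
  {PS : Type v} [AddCommGroup PS] [Module A PS]
  {D₂ : Type v} [AddCommGroup D₂] [Module A D₂]
  {DS : Type v} [AddCommGroup DS] [Module A DS]
  {P : Type v} [AddCommGroup P] [Module A P]
  {H : Type v} [AddCommGroup H] [Module A H]
  {SelRel : Type v} [AddCommGroup SelRel] [Module A SelRel]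

/-- **(PERF₂) ⟹ the lift hypothesis of G2** on the one-pair road: a character of `D₂ × D_S` vanishing on `E⁺ × D_S` is `toChar (h₂, 0)`
with `c₂ h₂` vanishing on `E⁺`, hence `(h₂, 0) ∈ ker π` — uses only the SURJECTIVITY of the local duality map `c₂ : P₀ → D₂⋆` at `2`
(local Tate duality in the tower), no injectivity and nothing at `S₀`. [cite: MilneADT2006, Ch. I, Cor. 2.3] -/
theorem lift_of_surjective_two (c₂ : P₀ →ₗ[A] CharacterModule D₂) (cS : PS →ₗ[A] CharacterModule DS)
    (hsurj : Function.Surjective c₂) (Eplus : Submodule A D₂) (π : (P₀ × PS) →ₗ[A] P)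
    (hπker : ∀ h₂ : P₀, (∀ e ∈ Eplus, c₂ h₂ e = 0) → π (h₂, 0) = 0)
    (toChar : (P₀ × PS) →ₗ[A] CharacterModule (D₂ × DS)) (htoChar : ∀ (t : P₀ × PS) (x : D₂ × DS), toChar t x = c₂ t.1 x.1 + cS t.2 x.2) :
    ∀ χ : CharacterModule (D₂ × DS), (∀ e ∈ Eplus.prod ⊤, χ e = 0) →
      ∃ h : P₀ × PS, π h = 0 ∧ toChar h = χ := by
  intro χ hχ
  obtain ⟨h₂, hh₂⟩ := hsurj (CharacterModule.dual (LinearMap.inl A D₂ DS) χ)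
  have hη : ∀ e ∈ Eplus, c₂ h₂ e = 0 := fun e he ↦ by
    rw [hh₂]
    exact hχ (e, 0) ⟨he, Submodule.mem_top⟩
  refine ⟨(h₂, 0), hπker h₂ hη, ?_⟩
  ext x
  have hx : x = (x.1, 0) + (0, x.2) := by ext <;> simp
  have hx0 : χ ((0 : D₂), x.2) = 0 := hχ (0, x.2) ⟨Eplus.zero_mem, Submodule.mem_top⟩
  rw [htoChar, map_zero, hh₂]
  show χ (LinearMap.inl A D₂ DS x.1) + 0 = χ x
  rw [add_zero, LinearMap.inl_apply]
  conv_rhs => rw [hx, map_add, hx0, add_zero]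

/-- **S4⊕ ⟸ S4rel + S4perf — the deep half of the one-pair road from the RELAXED deep half.**  Data as in the module docstring;
hypotheses: `π` onto with `ker π ⊇ ann(E⁺) × 0`, `pair ∘ π = pair'|Sg`, `locd = π ∘ loc'`, (PERF₂) `c₂` onto, (DH)_rel.  Conclusion: the N5
binder `hDH` VERBATIM for `(P, pair, locd)`.  The sign enters only through `Sg = loc₂⁻¹(E⁺)` and `ker π`; Poitou–Tate is used only for the
relaxed structure. [cite: MilneADT2006, Ch. I, Thm. 4.10 (b)] [cite: Rubin2000, App. B §B.3] [cite: Kobayashi2003, Thm. 7.3 ((7.17)–(7.21))] -/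
theorem deepHalfSigma_of_relaxed
    (c₂ : P₀ →ₗ[A] CharacterModule D₂) (cS : PS →ₗ[A] CharacterModule DS) (hsurj : Function.Surjective c₂)
    (loc₂ : SelRel →ₗ[A] D₂) (locS : SelRel →ₗ[A] DS) (Eplus : Submodule A D₂)
    (Sg : Submodule A SelRel) (hSg : ∀ s, s ∈ Sg ↔ loc₂ s ∈ Eplus)
    (π : (P₀ × PS) →ₗ[A] P) (hπ : Function.Surjective π)
    (hπker : ∀ h₂ : P₀, (∀ e ∈ Eplus, c₂ h₂ e = 0) → π (h₂, 0) = 0)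
    (pair : P →ₗ[A] CharacterModule Sg)
    (hcompat : ∀ (t : P₀ × PS) (s : Sg), pair (π t) s = c₂ t.1 (loc₂ s) + cS t.2 (locS s))
    (loc' : H →ₗ[A] P₀ × PS) (locd : H →ₗ[A] P) (hloc : ∀ x, locd x = π (loc' x))
    (hDHrel : ∀ t : P₀ × PS, (∀ s : SelRel, c₂ t.1 (loc₂ s) + cS t.2 (locS s) = 0) →
      ∃ a : A, a ≠ 0 ∧ ∃ x : H, a • t = loc' x) :
    ∀ z : P, pair z = 0 → ∃ a : A, a ≠ 0 ∧ ∃ x : H, a • z = locd x := by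
  -- the relaxed local duality character `(t₂, t_S) ↦ ((x₂, x_S) ↦ ⟨t₂, x₂⟩₂ + ⟨t_S, x_S⟩_S)` (a local term, no definition)
  let toChar : (P₀ × PS) →ₗ[A] CharacterModule (D₂ × DS) :=
    CharacterModule.dual (LinearMap.fst A D₂ DS) ∘ₗ c₂ ∘ₗ LinearMap.fst A P₀ PS +
      CharacterModule.dual (LinearMap.snd A D₂ DS) ∘ₗ cS ∘ₗ LinearMap.snd A P₀ PS
  have htoChar : ∀ (t : P₀ × PS) (x : D₂ × DS), toChar t x = c₂ t.1 x.1 + cS t.2 x.2 := fun _ _ ↦ rfl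
  let pair' : (P₀ × PS) →ₗ[A] CharacterModule SelRel := CharacterModule.dual (loc₂.prod locS) ∘ₗ toChar
  have hpair' : ∀ (t : P₀ × PS) (s : SelRel), pair' t s = c₂ t.1 (loc₂ s) + cS t.2 (locS s) := fun _ _ ↦ rfl
  refine deepHalf_of_coarsening π hπ pair' Sg pair (fun t s ↦ by rw [hpair', hcompat]) loc' locd hloc
    (fun t ht ↦ hDHrel t fun s ↦ ?_) ?_
  · rw [← hpair', ht]
    rfl
  · refine split_of_lift π toChar (loc₂.prod locS) pair' (fun _ _ ↦ rfl) (Eplus.prod ⊤) Sg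
      (fun s ↦ ?_) (lift_of_surjective_two c₂ cS hsurj Eplus π hπker toChar htoChar)
    rw [hSg]
    exact ⟨fun h ↦ ⟨h, Submodule.mem_top⟩, fun h ↦ h.1⟩

end OnePair

/-! ## §D  The N5 consumer re-fed: S2's λ-inequality from (DH)_rel + (PERF₂) instead of (DH)⊕ -/

section Consumer

variable {A : Type u} [CommRing A] (K : Type w) [Field K] [Algebra A K] [IsFractionRing A K]
  {P₀ : Type v} [AddCommGroup P₀] [Module A P₀]
  {PS : Type v} [AddCommGroup PS] [Module A PS]
  {D₂ : Type v} [AddCommGroup D₂] [Module A D₂]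
  {DS : Type v} [AddCommGroup DS] [Module A DS]
  {P : Type v} [AddCommGroup P] [Module A P]
  {H : Type v} [AddCommGroup H] [Module A H]
  {SelRel : Type v} [AddCommGroup SelRel] [Module A SelRel]

/-- **`d ≤ λ(Sg⋆)` with S4⊕ replaced by S4rel + S4perf.**  = `CharIdealLambda.le_finrank_baseChange_characterModule_of_duality_decorated`
with its `hDH` supplied by `deepHalfSigma_of_relaxed`; every other binder ((EH_Z) on `Z`, (ORTH) for `Sel₀ = Fine`, the finiteness
instances, `hi`/`hii`/`hPT`) is passed through unchanged.  Closes nothing. [cite: Kobayashi2003, Thm. 7.3 ((7.17)–(7.21))]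
[cite: MilneADT2006, Ch. I, Thm. 4.10 (b)] -/
theorem le_finrank_baseChange_characterModule_of_relaxedDuality_decorated
    (c₂ : P₀ →ₗ[A] CharacterModule D₂) (cS : PS →ₗ[A] CharacterModule DS) (hsurj : Function.Surjective c₂)
    (loc₂ : SelRel →ₗ[A] D₂) (locS : SelRel →ₗ[A] DS) (Eplus : Submodule A D₂)
    (Sg : Submodule A SelRel) (hSg : ∀ s, s ∈ Sg ↔ loc₂ s ∈ Eplus)
    (π : (P₀ × PS) →ₗ[A] P) (hπ : Function.Surjective π)
    (hπker : ∀ h₂ : P₀, (∀ e ∈ Eplus, c₂ h₂ e = 0) → π (h₂, 0) = 0)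
    (pair : P →ₗ[A] CharacterModule Sg)
    (hcompat : ∀ (t : P₀ × PS) (s : Sg), pair (π t) s = c₂ t.1 (loc₂ s) + cS t.2 (locS s))
    (loc' : H →ₗ[A] P₀ × PS) (locd : H →ₗ[A] P) (hloc : ∀ x, locd x = π (loc' x))
    (hDHrel : ∀ t : P₀ × PS, (∀ s : SelRel, c₂ t.1 (loc₂ s) + cS t.2 (locS s) = 0) →
      ∃ a : A, a ≠ 0 ∧ ∃ x : H, a • t = loc' x)
    (Z : Submodule A H) (Sel₀ : Submodule A Sg) {H2 : Type v} [AddCommGroup H2] [Module A H2]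
    (hEH : ∀ z ∈ Z, pair (locd z) = 0) (horth : ∀ s ∈ Sel₀, ∀ z : P, pair z s = 0)
    [Module.Finite K (K ⊗[A] (H ⧸ Z))] [Module.Finite K (K ⊗[A] (P ⧸ Z.map locd))]
    [Module.Finite K (K ⊗[A] CharacterModule Sg)] {d e : ℕ}
    (hi : d + e ≤ Module.finrank K (K ⊗[A] (P ⧸ Z.map locd)))
    (hii : Module.finrank K (K ⊗[A] (H ⧸ Z)) ≤ Module.finrank K (K ⊗[A] H2) + e)
    (hPT : Module.finrank K (K ⊗[A] H2) ≤ Module.finrank K (K ⊗[A] CharacterModule Sel₀)) :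
    d ≤ Module.finrank K (K ⊗[A] CharacterModule Sg) :=
  CharIdealLambda.le_finrank_baseChange_characterModule_of_duality_decorated K pair locd Z Sel₀ hEH horth
    (deepHalfSigma_of_relaxed c₂ cS hsurj loc₂ locS Eplus Sg hSg π hπ hπker pair hcompat loc' locd hloc hDHrel) hi hii hPT

end Consumer

end Summit.BirchSwinnertonDyer.BirchSwinnertonDyer.Theorems.CharIdealLambda

end
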